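import Summits.QuantumFields.YangMills.Theorems.AllWindowsColdBoxBoxHighLineHodgePoincareStub
import Summits.QuantumFields.YangMills.Theorems.AllWindowsColdBoxBoxHighLineKernelHodgeForm
import Summits.QuantumFields.YangMills.Theorems.AllWindowsColdBoxBoxHighLineLandauSecondOrder

/-!
# LINE-19 «landau-sector-relative-bl» (⟨stmt-QuantumFields-24004⟩ `BoxHighWindowsSU22`): stubs S1, S2, S5 BY NAME — ledger stub credit

Bookkeeping row «LINE-19 STUB CREDIT BY NAME» (planner ym-idea-2 g19, 2026-08-30T03:05:08Z; LEAD seat ym-line-sfw-p2 g79, free hands).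
The registered skeleton `Cruxes/BoxHighWindowsSU22/Lines/landau_sector_relative_bl.lean` (v13, sha16 f0928380c7a56269, re-registered
03:02:20Z) lists S1 `stub_hodgePoincare : HodgePoincareColdBox`, S2 `stub_kernelHodgeForm : DirProjKernelHodgeForm` and S5
`stub_landauSecondOrder : ∀ θL, θL < 5/64 → … → LandauRelativeComparisonBulk θL` as ACTIVE on the ledger, although all three are tree
theorems: ✓`AllWindowsColdBoxBoxHighLine.stub_hodgePoincare` (`…HodgePoincareStub.lean`), ✓`AllWindowsColdBoxBoxHighLine.stub_kernelHodgeForm`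
(`…KernelHodgeForm.lean`) — both filed in helper mode / before the registration — and ✓`AllWindowsColdBoxBoxHighLine.landauSecondOrder`
(✓p747508, `…LandauSecondOrder.lean`, filed without the `stub_` name).  This file re-declares the three under the registered names and the
registered signatures VERBATIM (skeleton l.199, l.201, l.235–238), in the fresh sub-namespace `…AllWindowsColdBoxBoxHighLine.LandauSectorRelativeBL`
(so no fully-qualified name collides), each as a one-line citation of the landed theorem — proposed in STUB mode (`--supports stmt-QuantumFields-24004`)
so that the ledger's stub table matches the tree: after this, LINE-19's only active stub is the declared residual S6 `stub_boxWindowHigh13`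
(= ⟨24336⟩ ↔ ⟨25580⟩ ∧ ⟨25584⟩ by ✓p757640 `Split11.boxWindowHighSU2213_iff_mid_and_high11`).

The Props are the Theorems-side line letters of ✓`…BoxHighWindowsSU22LineDefs` / ✓`…BulkCurrency` (`HodgePoincareColdBox`, `DirProjKernelHodgeForm`,
`LandauVarianceBounded`, `LandauKernelDecay`, `LandauBootstrapBound`, `GaugeBallReduction`, `LandauRelativeComparisonBulk`), definitionally equal to the
skeleton's own copies.

HONEST LABEL: ledger bookkeeping; proves nothing new (three citations); ⟨24004⟩ `BoxHighWindowsSU22`, ⟨24336⟩, the MID item ⟨25580⟩ (closer in flight,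
fcl-p3 g27) and the declared RG residual ⟨25584⟩ `BoxWindowHighSU2211` remain OPEN at the time of writing; route AllWindowsColdBox DRAFT; no rung or
summit is proved; **the Yang–Mills mass gap is NOT proved by this file; no summit is proved by a line.**
-/

set_option autoImplicit false

namespace Summit.QuantumFields.YangMills.Theorems.AllWindowsColdBoxBoxHighLine.LandauSectorRelativeBL

/-- **Stub S1 of LINE-19, BY NAME** (registered signature verbatim): the Hodge–Poincaré inequality in the cold box —
citation of ✓`AllWindowsColdBoxBoxHighLine.stub_hodgePoincare` (`…HodgePoincareStub.lean`). -/
theorem stub_hodgePoincare : HodgePoincareColdBox :=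
  _root_.Summit.QuantumFields.YangMills.Theorems.AllWindowsColdBoxBoxHighLine.stub_hodgePoincare

/-- **Stub S2 of LINE-19, BY NAME** (registered signature verbatim): the Dirichlet-projected kernel Hodge form —
citation of ✓`AllWindowsColdBoxBoxHighLine.stub_kernelHodgeForm` (`…KernelHodgeForm.lean`). -/
theorem stub_kernelHodgeForm : DirProjKernelHodgeForm :=
  _root_.Summit.QuantumFields.YangMills.Theorems.AllWindowsColdBoxBoxHighLine.stub_kernelHodgeForm

/-- **Stub S5 of LINE-19, BY NAME** (registered signature verbatim, skeleton v13 l.235–238): the second-order Landau-sector comparison for every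
`θL < 5/64` — citation of ✓`AllWindowsColdBoxBoxHighLine.landauSecondOrder` (✓p747508; `:= landauSecondOrder_of K3 K4`). -/
theorem stub_landauSecondOrder : ∀ θL : ℝ, θL < 5 / 64 → HodgePoincareColdBox → DirProjKernelHodgeForm →
    LandauVarianceBounded ∧ LandauKernelDecay → LandauBootstrapBound →
    (∃ κ : ℝ, 0 < κ ∧ κ < 1 / 2 - 3 * θL ∧ GaugeBallReduction θL κ) →
    LandauRelativeComparisonBulk θL :=
  _root_.Summit.QuantumFields.YangMills.Theorems.AllWindowsColdBoxBoxHighLine.landauSecondOrder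

end Summit.QuantumFields.YangMills.Theorems.AllWindowsColdBoxBoxHighLine.LandauSectorRelativeBL
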